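import Literature.Probability.Percolation.HalfPlaneTwoArmRadii
import Literature.Probability.Percolation.CharLengthWRSW
import Literature.Probability.Percolation.NearCriticalBoundaryFacts
import HarnessLib

/-!
# The half-plane two-arm probability at two radii below the correlation length

Topic `Literature/Probability/Percolation`; family `crit-perc`, statement **crit-perc.S16**
(`Literature.Probability.Percolation.triTheta_exponent`). The discharge of the named fact
`Werner2009_halfPlane_twoArm` (`NearCriticalBoundaryFacts.lean`): for `1/2 ≤ t < 1/2 + δ` and
`n₀ ≤ m ≤ n ≤ L(t, ε)` (Werner's correlation length `charLengthW`),
`P_t(open and closed arms in the upper half-plane from ∂S_m to ∂S_n) ≤ C m / n`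
(W. Werner, *Lectures on two-dimensional critical percolation* (2009), Lecture 6, §3, "uniform
estimates … of two-arms in the half-plane" for `n ≤ L(p)`; P. Nolin, EJP 13 (2008), Thm. 24 (i)
"uniformly in `p`, `N ≤ L(p)`").

The proof of `HalfPlaneTwoArmRadii.lean` (Kesten's inner separation) is uniform in `p`: its only
inputs are RSW lower bounds for both colours, which hold uniformly below the characteristic length
(`CharLengthWRSW.lean`: `charLengthW_le_charLength`, `real_hpGood_le_div_lt_charLengthW`;
`lt_triLRCrossingProb_of_lt_charLength`). Here the one-scale bounds and the multiscale sum are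
redone with `p` and these inputs as hypotheses (`real_compl_gsc_le_gen`, `real_armTwo_gsc_le_gen`,
`real_armTwo_le_gen`), and specialised below `L(t, ε)`.

## References

* W. Werner, Lectures on two-dimensional critical percolation, IAS/Park City Math. Ser. 16 (2009),
  Lecture 6, §3; Lecture 2, first exercise sheet [WernerPCMI2009].
* P. Nolin, Near-critical percolation in two dimensions, *Electron. J. Probab.* 13 (2008), Thm. 24
  (i), Prop. 17, §4.4–§4.6 [arXiv 0711.4948: Thm. 23 (i), Prop. 16] [Nolin2008].
* H. Kesten, Scaling relations for 2D-percolation, *Comm. Math. Phys.* 109 (1987), Lemma 4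
  [KestenScalingCMP1987].

## Mathlib / tree

Tree: `radiiL`, …, `radii_params`, `shellFin`, `dFin`, `determinedBy_armTwo_gsc`,
`disjoint_shellFin_dFin`, `disjoint_shellFin_shellFin`, `scales_sep`, `armEv_mono_inner'`,
`exists_T_K` (`HalfPlaneTwoArmRadii.lean`), `Gsc`, `good_subset_gsc`, `armEv_inter_gsc_subset`,
`determinedBy_gsc` (`TriUQuadScaleGood.lean`), `real_zev_aev_le` (`TriUQuadScale.lean`),
`real_le_sum_firstGood` (`MultiscaleSum.lean`), `TriQuad.real_not_good_le`, `real_uLRPath_le`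
(`TriUQuadRSW.lean`), `domArmEvent_subset_uOpen_inter_uClosed` (`HalfPlaneArmsUQuad.lean`),
`charLengthW_le_charLength`, `real_hpGood_le_div_lt_charLengthW` (`CharLengthWRSW.lean`),
`lt_triLRCrossingProb_of_lt_charLength`, `charLength_symm`, `charLengthW_symm`,
`le_triLRCrossingProb_long_of_rhombus`, `TriHexExclusive.triLRCrossingProb_mono`.
-/

noncomputable section

open Set MeasureTheory unitInterval

namespace Literature.Probability.Percolation

open LatticeModels

/-! ### RSW inputs below the characteristic length -/

/-- **Rhombi and long parallelograms are crossed by both colours below `L_ε`.** For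
`0 < ε < 1/2`, `15 ≤ k`, `k < L_ε(t)` whenever `t ≠ 1/2`, and `q ∈ {t, 1 - t}`:
`ε ≤ P_q(LR(m, m))` for all `m ≤ k` and `((ε/2)^396)^4 ε^3 ≤ P_q(LR(4k, k))`. [cite: Nolin2008, §3.1 Thm. "Russo–Seymour–Welsh" and eq. (3.4) (arXiv 0711.4948: Thm. 2)] [cite: WernerPCMI2009, Lecture 6, §3 (first sentence)] -/
theorem le_triLRCrossingProb_rhombus_of_lt_charLength {ε : ℝ} (hε' : ε < 1 / 2) (t : unitInterval) {m : ℕ}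
    (hL : (t : ℝ) ≠ 1 / 2 → m < charLength ε t) (q : unitInterval) (hq : q = t ∨ q = σ t) :
    ε ≤ triLRCrossingProb q m m := by
  by_cases ht : (t : ℝ) = 1 / 2
  · have hth : t = half := Subtype.ext (by rw [ht]; simp [half])
    have hs : σ t = half := by rw [hth]; exact Subtype.ext (by simp [half]; norm_num)
    have hqh : q = half := by
      rcases hq with h | h
      · rw [h, hth]
      · rw [h, hs]
    rw [hqh, triLRCrossingProb_half_self]; linarith
  · have hlt := lt_triLRCrossingProb_of_lt_charLength (ε := ε) (p := t) (n := m) (hL ht)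
    have hmq : min t (σ t) ≤ q := by
      rcases hq with h | h
      · rw [h]; exact min_le_left _ _
      · rw [h]; exact min_le_right _ _
    exact hlt.le.trans (TriHexExclusive.triLRCrossingProb_mono hmq m m)

/-- The long parallelogram `4k × k` below `L_ε` (`15 ≤ k < L_ε(t)` when `t ≠ 1/2`). [cite: Nolin2008, §3.1 Thm. "Russo–Seymour–Welsh" (arXiv 0711.4948: Thm. 2)] -/
theorem rsw_inputs_of_lt_charLength {ε : ℝ} (hε : 0 < ε) (hε' : ε < 1 / 2) (t : unitInterval) {k : ℕ}
    (hk : 15 ≤ k) (hL : (t : ℝ) ≠ 1 / 2 → k < charLength ε t) (q : unitInterval) (hq : q = t ∨ q = σ t) :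
    (∀ m : ℕ, m ≤ k → ε ≤ triLRCrossingProb q m m) ∧ ((ε / 2) ^ 396) ^ 4 * ε ^ 3 ≤ triLRCrossingProb q (4 * k) k := by
  have hrh : ∀ m : ℕ, m ≤ k → ε ≤ triLRCrossingProb q m m := fun m hm =>
    le_triLRCrossingProb_rhombus_of_lt_charLength hε' t (fun hne => lt_of_le_of_lt hm (hL hne)) q hq
  exact ⟨hrh, le_triLRCrossingProb_long_of_rhombus q hε.le hk hrh⟩

/-! ### One scale, general `p` -/

section OneScale

variable (p : unitInterval) {T K s : ℕ}

/-- **The trimmed good event fails with probability at most `1/6`, general `p`**, given RSW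
lower bounds `c₀` for both colours at the scales `15 ≤ k ≤ s` and the bounds `1 - c_q` for the
inner–outer crossing probabilities of `U_{s,2s}` in both colours. [cite: Nolin2008, §4.4, proof of Lemma 15 (arXiv 0711.4948: Lemma 14)] -/
theorem real_compl_gsc_le_gen (hs1 : 1 ≤ s) (hs : 16 * radiiL K K ≤ s) {c₀ cq : ℝ} (hc₀ : 0 < c₀) (hc₀1 : c₀ ≤ 1)
    (hrsw : ∀ k : ℕ, 15 ≤ k → k ≤ s →
      c₀ ≤ triLRCrossingProb p (4 * k) k ∧ c₀ ≤ triLRCrossingProb (σ p) (4 * k) k)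
    (hq : (triSitePercolation p).real {ω | (uQ s hs1).LRPath ω} ≤ 1 - cq)
    (hq' : (triSitePercolation (σ p)).real {ω | (uQ s hs1).LRPath ω} ≤ 1 - cq)
    (hT : 2 * (1 - cq) ^ T ≤ 1 / 12) (hK : 8 * T * (1 - c₀ ^ 4) ^ K ≤ 1 / 12) :
    (triSitePercolation p).real (Gsc s hs1 T K (radiiM₀ K K s) K (radiiM₁ K K s))ᶜ ≤ 1 / 6 := by
  obtain ⟨hM16, -, hKM₀, hMA, -, -⟩ := radii_params hs
  set M₁ := radiiM₁ K K s
  set M₀ := radiiM₀ K K s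
  have hM₀15 : 15 ≤ M₀ := by show 15 ≤ 2 * (radiiA K K s + M₁) + 2 * M₁ + 2; omega
  have hM₁M₀ : M₁ ≤ M₀ := by show M₁ ≤ 2 * (radiiA K K s + M₁) + 2 * M₁ + 2; omega
  have hscale : ∀ (M : ℕ), 15 ≤ M → M ≤ M₀ → ∀ i < K, 15 ≤ 3 ^ i * M ∧ 3 ^ i * M ≤ s := by
    intro M hM hMM i hi
    have h1 : 1 ≤ 3 ^ i := Nat.one_le_pow _ _ (by norm_num)
    have h3 : 3 ^ i ≤ 3 ^ (K - 1) := Nat.pow_le_pow_right (by norm_num) (by omega)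
    refine ⟨le_trans hM (Nat.le_mul_of_pos_left _ h1), ?_⟩
    calc 3 ^ i * M ≤ 3 ^ (K - 1) * M₀ := Nat.mul_le_mul h3 hMM
      _ ≤ 2 * 3 ^ (K - 1) * M₀ := by nlinarith
      _ ≤ s := hKM₀
  have hframe : ∀ (M : ℕ), 15 ≤ M → M ≤ M₀ → ∀ i < K,
      c₀ ≤ triLRCrossingProb p (4 * (3 ^ i * M)) (3 ^ i * M) ∧
        c₀ ≤ triLRCrossingProb (σ p) (4 * (3 ^ i * M)) (3 ^ i * M) := by
    intro M hM hMM i hi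
    obtain ⟨h15, hs'⟩ := hscale M hM hMM i hi
    exact hrsw _ h15 hs'
  calc (triSitePercolation p).real (Gsc s hs1 T K M₀ K M₁)ᶜ
      ≤ (triSitePercolation p).real {ω | ¬ (uQ s hs1).Good T K M₀ K M₁ (uInner s) ω} :=
        measureReal_mono (compl_subset_comm.1 fun ω hω => good_subset_gsc T K M₀ K M₁ (by simpa using hω))
          (measure_ne_top _ _)
    _ ≤ _ := TriQuad.real_not_good_le p T K (by omega) K (by omega) (uInner s) hc₀.le hc₀1 hc₀.le hc₀1
          (fun i hi => (hframe M₀ hM₀15 le_rfl i hi).1) (fun i hi => (hframe M₁ (by omega) hM₁M₀ i hi).1)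
          (fun i hi => (hframe M₀ hM₀15 le_rfl i hi).2) (fun i hi => (hframe M₁ (by omega) hM₁M₀ i hi).2)
    _ ≤ 1 / 6 := by
        have h0 : 0 ≤ (triSitePercolation p).real {ξ | (uQ s hs1).LRPath ξ} := measureReal_nonneg
        have h0' : 0 ≤ (triSitePercolation (σ p)).real {ξ | (uQ s hs1).LRPath ξ} := measureReal_nonneg
        have hpow : (triSitePercolation p).real {ξ | (uQ s hs1).LRPath ξ} ^ T ≤ (1 - cq) ^ T :=
          pow_le_pow_left₀ h0 hq T
        have hpow' : (triSitePercolation (σ p)).real {ξ | (uQ s hs1).LRPath ξ} ^ T ≤ (1 - cq) ^ T :=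
          pow_le_pow_left₀ h0' hq' T
        nlinarith [hpow, hpow', hT, hK]

/-- **The two arms and the trimmed good event, one scale, general `p`** (`16 L ≤ s`, `4 s ≤ M'`,
`N = 2M'`): given the band RSW inputs `δ₁ = c₀` (long crossings, both colours, scales `≤ s`) and
`δ₂ = ε` (rhombi, both colours), and the good-point bounds `C_g / M'` in both colours,
`P_p ≤ (10 C_g / ε_B²) · s / M'`. [cite: Nolin2008, §4.5, proof of Prop. 17 (arXiv 0711.4948: Prop. 16)] [cite: KestenScalingCMP1987, Lemma 4] -/
theorem real_armTwo_gsc_le_gen (hs1 : 1 ≤ s) (hs : 16 * radiiL K K ≤ s) {M' N : ℕ} (hNM : N = 2 * M') (hsM : 4 * s ≤ M')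
    {c₀ ε Cg : ℝ} (hc₀ : 0 < c₀) (hε : 0 < ε)
    (hrsw : ∀ k : ℕ, 15 ≤ k → k ≤ s →
      c₀ ≤ triLRCrossingProb p (4 * k) k ∧ c₀ ≤ triLRCrossingProb (σ p) (4 * k) k)
    (hrh : ∀ m : ℕ, m ≤ s → ε ≤ triLRCrossingProb p m m ∧ ε ≤ triLRCrossingProb (σ p) m m)
    (hCg : (triSitePercolation p).real (hpGood M' 0) ≤ Cg / M')
    (hCg' : (triSitePercolation (σ p)).real (hpGood M' 0) ≤ Cg / M') :
    (triSitePercolation p).real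
        ((armEv s N ∩ compl ⁻¹' armEv s N) ∩ Gsc s hs1 T K (radiiM₀ K K s) K (radiiM₁ K K s)) ≤
      10 * Cg / ((c₀ ^ (6 * radiiL K K - 1) * ε ^ (6 * radiiL K K - 1 - 1)) ^ 3) ^ 2 * s / M' := by
  obtain ⟨hM16, hsA, hKM₀, hMA, hjs, h4A⟩ := radii_params hs
  set L := radiiL K K with hL
  set M₁ := radiiM₁ K K s
  set A := radiiA K K s
  set M₀ := radiiM₀ K K s
  have hL0 : 0 < L := by rw [hL]; unfold radiiL; positivity
  have hL1 : 1 ≤ L := hL0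
  set j : ℕ := 6 * L - 1 with hj
  set h : ℕ := M₁ - 1 with hh
  have hh15 : 15 ≤ h := by omega
  have hhs : h ≤ s := by
    have : M₁ ≤ s := le_trans hMA (by omega)
    omega
  set εB : ℝ := (c₀ ^ j * ε ^ (j - 1)) ^ 3 with hεB
  have hεB0 : 0 < εB := by positivity
  -- RSW inputs for the band
  obtain ⟨hr, hr'⟩ := hrsw h hh15 hhs
  have h₁ : c₀ ≤ triLRCrossingProb p (2 * h) h := hr.trans (triLRCrossingProb_anti_width p (by omega) h)
  have h₁' : c₀ ≤ triLRCrossingProb (σ p) (2 * h) h := hr'.trans (triLRCrossingProb_anti_width (σ p) (by omega) h)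
  obtain ⟨h₂, h₂'⟩ := hrh h hhs
  have hM'1 : 1 ≤ M' := by omega
  have hj1 : 1 ≤ j := by omega
  have hWh : M₁ = h + 1 := by omega
  have hjs' : 2 * s ≤ (j + 1) * h := by
    have : j + 1 = 6 * L := by omega
    rw [this]; exact hjs
  have key := real_zev_aev_le (hs := hs1) (N := N) (T := T) (K := K) (M₀ := M₀) (K' := K) (M₁ := M₁) (W := M₁)
    (A := A) (h := h) (j := j) (M' := M') (δ₁ := c₀) (δ₂ := ε) (δ₁' := c₀) (δ₂' := ε) p hc₀.le
    hε.le h₁ h₂ hc₀.le hε.le h₁' h₂' hj1 hWh hjs' (by omega) le_rfl hMA le_rfl le_rfl hsA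
    (by omega) hKM₀ hNM (by omega)
  have hsub := armEv_inter_gsc_subset (hs := hs1) (N := N) (by omega) T K M₀ K M₁
  have hP := measureReal_mono hsub (measure_ne_top (triSitePercolation p) _)
  have hM'0 : (0 : ℝ) < M' := by exact_mod_cast hM'1
  have hsA' : (A : ℝ) ≤ s := by exact_mod_cast (by omega : A ≤ s)
  have hs1' : (1 : ℝ) ≤ s := by exact_mod_cast hs1
  have hrhs : (2 * ((s : ℝ) + A) + 1) * ((triSitePercolation p).real (hpGood M' 0) +
      (triSitePercolation (σ p)).real (hpGood M' 0)) ≤ 10 * Cg * s / M' := by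
    have h5 : 2 * ((s : ℝ) + A) + 1 ≤ 5 * s := by linarith
    have hg0 : 0 ≤ (triSitePercolation p).real (hpGood M' 0) := measureReal_nonneg
    have hg0' : 0 ≤ (triSitePercolation (σ p)).real (hpGood M' 0) := measureReal_nonneg
    have hsum : (triSitePercolation p).real (hpGood M' 0) + (triSitePercolation (σ p)).real (hpGood M' 0) ≤
        2 * (Cg / M') := by linarith
    calc (2 * ((s : ℝ) + A) + 1) * ((triSitePercolation p).real (hpGood M' 0) +
          (triSitePercolation (σ p)).real (hpGood M' 0))
        ≤ 5 * s * (2 * (Cg / M')) := mul_le_mul h5 hsum (by linarith) (by linarith)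
      _ = 10 * Cg * s / M' := by ring
  set PG := (triSitePercolation p).real ((armEv s N ∩ compl ⁻¹' armEv s N) ∩ Gsc s hs1 T K M₀ K M₁) with hPG
  have e1 : εB ^ 2 * PG ≤ εB ^ 2 * (triSitePercolation p).real
      (Zev s N hs1 T K M₀ ∩ {ω | ω ∈ Aev s N hs1 K M₁ ω}) := mul_le_mul_of_nonneg_left hP (by positivity)
  have e2 : εB ^ 2 * (triSitePercolation p).real (Zev s N hs1 T K M₀ ∩ {ω | ω ∈ Aev s N hs1 K M₁ ω}) ≤
      10 * Cg * s / M' := by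
    have := key
    push_cast at this
    rw [pow_two]
    exact this.trans hrhs
  have hεB2 : 0 < εB ^ 2 := by positivity
  have hmain : PG ≤ 10 * Cg * s / M' / εB ^ 2 := (le_div_iff₀' hεB2).2 (e1.trans e2)
  calc PG ≤ 10 * Cg * s / M' / εB ^ 2 := hmain
    _ = 10 * Cg / εB ^ 2 * s / M' := by ring

end OneScale

/-! ### The multiscale sum, general `p` -/

/-- **The two-arm bound at two radii with the RSW inputs as hypotheses**: for all positive
`c₀ ≤ 1`, `ε`, `c_q`, `C_g` there are `n₁, C₁` such that for every `p`, `k₀ ≥ n₁`, `M' ≥ 1`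
at which (both colours) the long crossings of scales `15 ≤ k ≤ M'` have probability `≥ c₀`, the
rhombi of scales `≤ M'` have probability `≥ ε`, the crossings of `U_{s,2s}`, `15 ≤ s ≤ M'`, have
probability `≤ 1 - c_q`, and the good-point probability at `M'` is `≤ C_g / M'`:
`P_p(open and closed crossings of U_{k₀, 2M'}) ≤ C₁ k₀ / M'`. [cite: Nolin2008, Prop. 17 and Thm. 24 (i), §4.4–§4.6 (arXiv 0711.4948: Prop. 16, Thm. 23 (i))] [cite: KestenScalingCMP1987, Lemma 4] -/
theorem real_armTwo_le_gen {c₀ ε cq Cg : ℝ} (hc₀ : 0 < c₀) (hc₀1 : c₀ ≤ 1) (hε : 0 < ε) (hcq : 0 < cq)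
    (hCg0 : 0 ≤ Cg) :
    ∃ n₁ : ℕ, ∃ C₁ : ℝ, 1 ≤ n₁ ∧ 4 ≤ C₁ ∧ ∀ (p : unitInterval) (k₀ M' : ℕ), n₁ ≤ k₀ → 1 ≤ M' →
      (∀ k : ℕ, 15 ≤ k → k ≤ M' → c₀ ≤ triLRCrossingProb p (4 * k) k ∧ c₀ ≤ triLRCrossingProb (σ p) (4 * k) k) →
      (∀ m : ℕ, m ≤ M' → ε ≤ triLRCrossingProb p m m ∧ ε ≤ triLRCrossingProb (σ p) m m) →
      (∀ (s : ℕ) (hs : 15 ≤ s), s ≤ M' →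
        (triSitePercolation p).real {ω | (uQ s (le_trans (by norm_num) hs)).LRPath ω} ≤ 1 - cq ∧
          (triSitePercolation (σ p)).real {ω | (uQ s (le_trans (by norm_num) hs)).LRPath ω} ≤ 1 - cq) →
      (triSitePercolation p).real (hpGood M' 0) ≤ Cg / M' →
      (triSitePercolation (σ p)).real (hpGood M' 0) ≤ Cg / M' →
      (triSitePercolation p).real (armEv k₀ (2 * M') ∩ compl ⁻¹' armEv k₀ (2 * M')) ≤ C₁ * k₀ / M' := by
  classical
  obtain ⟨T, K, hT, hK⟩ := exists_T_K hcq hc₀ hc₀1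
  set L := radiiL K K with hL
  have hL0 : 0 < L := by rw [hL]; unfold radiiL; positivity
  set cB : ℝ := ((c₀ ^ (6 * L - 1) * ε ^ (6 * L - 1 - 1)) ^ 3) ^ 2 with hcB
  have hcB0 : 0 < cB := by positivity
  have hC0 : 0 ≤ 20 * Cg / cB := by positivity
  refine ⟨16 * L, 20 * Cg / cB + 4, by omega, by linarith, ?_⟩
  intro p k₀ M' hk hM' hrsw hrh hq hg hg'
  have hk1 : 1 ≤ k₀ := by omega
  -- the number of scales
  have hex : ∃ j : ℕ, M' < 4 * (3 ^ j * k₀) :=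
    ⟨M', by have := Nat.lt_pow_self (by norm_num : 1 < 3) (n := M'); nlinarith⟩
  set J := Nat.find hex with hJ
  have hJspec : M' < 4 * (3 ^ J * k₀) := Nat.find_spec hex
  have hJmin : ∀ j < J, 4 * (3 ^ j * k₀) ≤ M' := fun j hj => not_lt.1 (Nat.find_min hex hj)
  have hsc1 : ∀ j : ℕ, 1 ≤ 3 ^ j * k₀ := fun j =>
    le_trans hk1 (Nat.le_mul_of_pos_left _ (Nat.one_le_pow _ _ (by norm_num)))
  have hscL : ∀ j : ℕ, 16 * L ≤ 3 ^ j * k₀ := fun j =>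
    hk.trans (Nat.le_mul_of_pos_left _ (Nat.one_le_pow _ _ (by norm_num)))
  have hsc15 : ∀ j : ℕ, 15 ≤ 3 ^ j * k₀ := fun j => le_trans (by omega) (hscL j)
  set N := 2 * M' with hN
  have hmain := real_le_sum_firstGood p (J := J)
    (E := armEv k₀ N ∩ compl ⁻¹' armEv k₀ N)
    (Es := fun j => armEv (3 ^ j * k₀) N ∩ compl ⁻¹' armEv (3 ^ j * k₀) N)
    (Gs := fun j => Gsc (3 ^ j * k₀) (hsc1 j) T K (radiiM₀ K K (3 ^ j * k₀)) K (radiiM₁ K K (3 ^ j * k₀)))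
    (D := fun j => dFin (3 ^ j * k₀) N (radiiA K K (3 ^ j * k₀)))
    (F := fun j => shellFin (3 ^ j * k₀) (radiiA K K (3 ^ j * k₀)))
    (fun j hj => by
      have hsN : 3 ^ j * k₀ + 1 ≤ N := by have := hJmin j hj; omega
      have hks : k₀ ≤ 3 ^ j * k₀ := Nat.le_mul_of_pos_left _ (Nat.one_le_pow _ _ (by norm_num))
      exact inter_subset_inter (armEv_mono_inner' hk1 hks hsN) (preimage_mono (armEv_mono_inner' hk1 hks hsN)))
    (fun j _ => determinedBy_armTwo_gsc (hsc1 j) le_rfl)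
    (fun j _ => by rw [coe_shellFin (hsc1 j)]; exact determinedBy_gsc le_rfl)
    (fun i j hij _ => disjoint_shellFin_shellFin (hsc1 i) (hsc1 j) (scales_sep hk hij))
    (fun i j hij _ => disjoint_shellFin_dFin (hsc1 i) (hsc1 j) (scales_sep hk hij))
  -- the pieces
  have hGc : ∀ i < J, (sitePercolation (Site 2) p).real
      (Gsc (3 ^ i * k₀) (hsc1 i) T K (radiiM₀ K K (3 ^ i * k₀)) K (radiiM₁ K K (3 ^ i * k₀)))ᶜ ≤ 1 / 6 := by
    intro i hi
    have hiM : 3 ^ i * k₀ ≤ M' := by have := hJmin i hi; omega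
    obtain ⟨hq1, hq2⟩ := hq (3 ^ i * k₀) (hsc15 i) hiM
    have := real_compl_gsc_le_gen p (T := T) (hsc1 i) (hscL i) hc₀ hc₀1
      (fun k hk15 hks => hrsw k hk15 (hks.trans hiM)) hq1 hq2 hT hK
    unfold triSitePercolation at this
    exact this
  have hprod : ∀ j ≤ J, ∏ i ∈ Finset.range j, (sitePercolation (Site 2) p).real
      (Gsc (3 ^ i * k₀) (hsc1 i) T K (radiiM₀ K K (3 ^ i * k₀)) K (radiiM₁ K K (3 ^ i * k₀)))ᶜ ≤ (1 / 6 : ℝ) ^ j := by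
    intro j hj
    calc ∏ i ∈ Finset.range j, (sitePercolation (Site 2) p).real
          (Gsc (3 ^ i * k₀) (hsc1 i) T K (radiiM₀ K K (3 ^ i * k₀)) K (radiiM₁ K K (3 ^ i * k₀)))ᶜ
        ≤ ∏ _i ∈ Finset.range j, (1 / 6 : ℝ) :=
          Finset.prod_le_prod (fun _ _ => measureReal_nonneg) fun i hi => hGc i (by have := Finset.mem_range.1 hi; omega)
      _ = (1 / 6 : ℝ) ^ j := by rw [Finset.prod_const, Finset.card_range]
  have hEs : ∀ j < J, (sitePercolation (Site 2) p).real
      ((armEv (3 ^ j * k₀) N ∩ compl ⁻¹' armEv (3 ^ j * k₀) N) ∩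
        Gsc (3 ^ j * k₀) (hsc1 j) T K (radiiM₀ K K (3 ^ j * k₀)) K (radiiM₁ K K (3 ^ j * k₀))) ≤
      10 * Cg / cB * (3 ^ j * k₀ : ℕ) / M' := by
    intro j hj
    have hjM : 3 ^ j * k₀ ≤ M' := by have := hJmin j hj; omega
    have := real_armTwo_gsc_le_gen p (T := T) (hsc1 j) (hscL j) hN (hJmin j hj) hc₀ hε
      (fun k hk15 hks => hrsw k hk15 (hks.trans hjM)) (fun m hm => hrh m (hm.trans hjM)) hg hg'
    unfold triSitePercolation at this
    rw [← hL] at this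
    exact this
  -- the geometric tail
  have hM'0 : (0 : ℝ) < M' := by exact_mod_cast hM'
  have hk0 : (0 : ℝ) < k₀ := by exact_mod_cast hk1
  have htail : (1 / 6 : ℝ) ^ J ≤ 4 * k₀ / M' := by
    have h2 : (M' : ℝ) < 4 * (3 ^ J * k₀) := by exact_mod_cast hJspec
    have h3 : (1 / 3 : ℝ) ^ J * 3 ^ J = 1 := by rw [← mul_pow]; norm_num
    rw [le_div_iff₀ hM'0]
    calc (1 / 6 : ℝ) ^ J * M' ≤ (1 / 3 : ℝ) ^ J * M' := by gcongr; norm_num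
      _ ≤ (1 / 3 : ℝ) ^ J * (4 * (3 ^ J * k₀)) := by gcongr
      _ = 4 * k₀ * ((1 / 3 : ℝ) ^ J * 3 ^ J) := by ring
      _ = 4 * k₀ := by rw [h3, mul_one]
  have hterm : ∀ j ∈ Finset.range J, (sitePercolation (Site 2) p).real
      ((armEv (3 ^ j * k₀) N ∩ compl ⁻¹' armEv (3 ^ j * k₀) N) ∩
        Gsc (3 ^ j * k₀) (hsc1 j) T K (radiiM₀ K K (3 ^ j * k₀)) K (radiiM₁ K K (3 ^ j * k₀))) *
      ∏ i ∈ Finset.range j, (sitePercolation (Site 2) p).real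
        (Gsc (3 ^ i * k₀) (hsc1 i) T K (radiiM₀ K K (3 ^ i * k₀)) K (radiiM₁ K K (3 ^ i * k₀)))ᶜ ≤
      (10 * Cg / cB * k₀ / M') * (1 / 2 : ℝ) ^ j := by
    intro j hj
    have hjJ := Finset.mem_range.1 hj
    have e : (10 * Cg / cB * (3 ^ j * k₀ : ℕ) / M') * (1 / 6 : ℝ) ^ j = (10 * Cg / cB * k₀ / M') * (1 / 2 : ℝ) ^ j := by
      have : ((3 : ℝ) ^ j) * (1 / 6 : ℝ) ^ j = (1 / 2 : ℝ) ^ j := by rw [← mul_pow]; norm_num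
      push_cast
      rw [← this]
      ring
    rw [← e]
    exact mul_le_mul (hEs j hjJ) (hprod j hjJ.le) (Finset.prod_nonneg fun _ _ => measureReal_nonneg)
      (by positivity)
  unfold triSitePercolation
  calc (sitePercolation (Site 2) p).real (armEv k₀ N ∩ compl ⁻¹' armEv k₀ N)
      ≤ _ := hmain
    _ ≤ ∑ j ∈ Finset.range J, (10 * Cg / cB * k₀ / M') * (1 / 2 : ℝ) ^ j + (1 / 6 : ℝ) ^ J :=
        add_le_add (Finset.sum_le_sum hterm) (hprod J le_rfl)
    _ = (10 * Cg / cB * k₀ / M') * ∑ j ∈ Finset.range J, (1 / 2 : ℝ) ^ j + (1 / 6 : ℝ) ^ J := by rw [Finset.mul_sum]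
    _ ≤ (10 * Cg / cB * k₀ / M') * 2 + 4 * k₀ / M' := by
        have hc : 0 ≤ 10 * Cg / cB * k₀ / M' := by positivity
        exact add_le_add (mul_le_mul_of_nonneg_left (sum_geometric_two_le J) hc) htail
    _ = (20 * Cg / cB + 4) * k₀ / M' := by ring

/-! ### The discharge -/

/-- **crit-perc.S16, near-critical half-plane two-arm probability at two radii** (discharge of
`Werner2009_halfPlane_twoArm`): for every `ε ∈ (0, 1)` there are `n₀, δ = 1/4, C` with
`P_t(Π_{TF}(m, n) in the upper half-plane) ≤ C m / n` for `1/2 ≤ t < 3/4`, `n₀ ≤ m ≤ n`, and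
`n ≤ L(t, ε)` when `t > 1/2`. Proof: the RSW inputs of `real_armTwo_le_gen` hold uniformly below
Werner's length (`charLengthW_le_charLength`, `lt_triLRCrossingProb_of_lt_charLength`,
`real_hpGood_le_div_lt_charLengthW`, `real_uLRPath_le`), and
`domArmEvent_subset_uOpen_inter_uClosed` reduces to the U-shaped half-annulus. [cite: WernerPCMI2009, Lecture 6, §3 ("uniform estimates … of two-arms in the half-plane" for n ≤ L(p)) and Lecture 2, first exercise sheet, 3] [cite: Nolin2008, Thm. 24 (i) (uniformly in p, N ≤ L(p); arXiv 0711.4948: Thm. 23 (i))] -/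
theorem Werner2009_halfPlane_twoArm_holds : Werner2009_halfPlane_twoArm := by
  refine ⟨1, one_pos, fun η hη _ => ?_⟩
  -- the RSW inputs below Werner's length
  obtain ⟨ε, hε, hε', hWN⟩ := charLengthW_le_charLength hη
  obtain ⟨Cg, hCg, hg⟩ := real_hpGood_le_div_lt_charLengthW hη
  obtain ⟨c₀, hc₀⟩ : ∃ c₀ : ℝ, c₀ = ((ε / 2) ^ 396) ^ 4 * ε ^ 3 := ⟨_, rfl⟩
  have hc₀0 : 0 < c₀ := by rw [hc₀]; positivity
  have hc₀1 : c₀ ≤ 1 := by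
    have := (rsw_inputs_of_lt_charLength hε hε' half (k := 15) le_rfl (fun h => absurd (by simp [half]) h)
      half (Or.inl rfl)).2
    rw [hc₀]
    exact this.trans (triLRCrossingProb_mem_Icc _ _ _).2
  have hCg0 : 0 ≤ Cg := hCg.le
  obtain ⟨n₁, C₁, hn₁, hC₁, hmain⟩ := real_armTwo_le_gen hc₀0 hc₀1 hε (show 0 < c₀ ^ 3 by positivity) hCg0
  refine ⟨n₁, 1 / 4, by norm_num, 16 * C₁ + 11, fun t ht1 ht2 m n hm hmn hnL => ?_⟩
  -- scales below the length
  have htq : |(t : ℝ) - 1 / 2| < 1 / 4 := by rw [abs_lt]; constructor <;> linarith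
  have hσt : |((σ t : unitInterval) : ℝ) - 1 / 2| < 1 / 4 := by
    rw [unitInterval.coe_symm_eq]; rw [abs_lt] at htq ⊢; constructor <;> linarith
  have hLt : (t : ℝ) ≠ 1 / 2 → n ≤ charLength ε t := fun hne => by
    have h1 : 1 / 2 < (t : ℝ) := lt_of_le_of_ne ht1 (Ne.symm hne)
    exact (hnL h1).trans (hWN t hne htq)
  have hrswk : ∀ k : ℕ, 15 ≤ k → k < n →
      c₀ ≤ triLRCrossingProb t (4 * k) k ∧ c₀ ≤ triLRCrossingProb (σ t) (4 * k) k := by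
    intro k hk hkn
    have hL' : (t : ℝ) ≠ 1 / 2 → k < charLength ε t := fun hne => lt_of_lt_of_le hkn (hLt hne)
    rw [hc₀]
    exact ⟨(rsw_inputs_of_lt_charLength hε hε' t hk hL' t (Or.inl rfl)).2,
      (rsw_inputs_of_lt_charLength hε hε' t hk hL' (σ t) (Or.inr rfl)).2⟩
  have hrhk : ∀ m' : ℕ, m' < n → ε ≤ triLRCrossingProb t m' m' ∧ ε ≤ triLRCrossingProb (σ t) m' m' := by
    intro m' hm'
    have hL' : (t : ℝ) ≠ 1 / 2 → m' < charLength ε t := fun hne => lt_of_lt_of_le hm' (hLt hne)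
    exact ⟨le_triLRCrossingProb_rhombus_of_lt_charLength hε' t hL' t (Or.inl rfl),
      le_triLRCrossingProb_rhombus_of_lt_charLength hε' t hL' (σ t) (Or.inr rfl)⟩
  -- the reduction to `U_{m+1, N}`
  have hm1 : 1 ≤ m := hn₁.trans hm
  have hm0 : (0 : ℝ) < m := by exact_mod_cast hm1
  have hn0 : (0 : ℝ) < n := by exact_mod_cast (hm1.trans hmn)
  have hP1 : (triSitePercolation t).real (domArmEvent ![true, false] m n upperHalfPlane) ≤ 1 := measureReal_le_one
  set M' : ℕ := (n - 1) / 4 with hM'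
  by_cases hcase : 1 ≤ M' ∧ m + 3 ≤ 2 * M'
  · obtain ⟨hM'1, hmM⟩ := hcase
    have hNn : 2 * (2 * M') + 1 ≤ n := by omega
    have hM'n : M' < n := by omega
    have h1 := measureReal_mono (domArmEvent_subset_uOpen_inter_uClosed hm1 (N := 2 * M') (by omega) hNn)
      (measure_ne_top (triSitePercolation t) _)
    have hqs : ∀ (s : ℕ) (hs : 15 ≤ s), s ≤ M' →
        (triSitePercolation t).real {ω | (uQ s (le_trans (by norm_num) hs)).LRPath ω} ≤ 1 - c₀ ^ 3 ∧
          (triSitePercolation (σ t)).real {ω | (uQ s (le_trans (by norm_num) hs)).LRPath ω} ≤ 1 - c₀ ^ 3 := by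
      intro s hs hsM
      obtain ⟨hr, hr'⟩ := hrswk s hs (by omega)
      have e1 := real_uLRPath_le t (k := s) (by omega) (by omega)
      have e2 := real_uLRPath_le (σ t) (k := s) (by omega) (by omega)
      rw [unitInterval.symm_symm] at e2
      have p1 : c₀ ^ 3 ≤ triLRCrossingProb (σ t) (4 * s) s ^ 3 := pow_le_pow_left₀ hc₀0.le hr' 3
      have p2 : c₀ ^ 3 ≤ triLRCrossingProb t (4 * s) s ^ 3 := pow_le_pow_left₀ hc₀0.le hr 3
      exact ⟨e1.trans (by linarith), e2.trans (by linarith)⟩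
    have hgt : (triSitePercolation t).real (hpGood M' 0) ≤ Cg / M' :=
      hg t M' htq hM'1 fun hne => by
        have h1' : 1 / 2 < (t : ℝ) := lt_of_le_of_ne ht1 (Ne.symm hne)
        exact le_trans (by omega) (hnL h1')
    have hgt' : (triSitePercolation (σ t)).real (hpGood M' 0) ≤ Cg / M' :=
      hg (σ t) M' hσt hM'1 fun hne => by
        rw [charLengthW_symm]
        have hne' : (t : ℝ) ≠ 1 / 2 := by
          intro h; apply hne; rw [unitInterval.coe_symm_eq, h]; norm_num
        have h1' : 1 / 2 < (t : ℝ) := lt_of_le_of_ne ht1 (Ne.symm hne')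
        exact le_trans (by omega) (hnL h1')
    have h2 := hmain t (m + 1) M' (by omega) hM'1 (fun k hk hkM => hrswk k hk (by omega))
      (fun m' hm' => hrhk m' (by omega)) hqs hgt hgt'
    have h8 : (n : ℝ) ≤ 8 * M' := by
      have : n ≤ 8 * M' := by omega
      exact_mod_cast this
    have hM'0 : (0 : ℝ) < M' := by exact_mod_cast hM'1
    calc (triSitePercolation t).real (domArmEvent ![true, false] m n upperHalfPlane)
        ≤ (triSitePercolation t).real (armEv (m + 1) (2 * M') ∩ compl ⁻¹' armEv (m + 1) (2 * M')) := h1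
      _ ≤ C₁ * (m + 1 : ℕ) / M' := h2
      _ ≤ (16 * C₁ + 11) * (m / n) := by
          push_cast
          rw [div_le_iff₀ hM'0]
          have hC0 : 0 ≤ C₁ := by linarith
          have hmn' : (m : ℝ) / 8 ≤ (m : ℝ) / n * M' := by
            rw [div_le_iff₀ (by norm_num : (0:ℝ) < 8)]
            calc (m : ℝ) = m / n * n := by field_simp
              _ ≤ m / n * (8 * M') := by gcongr
              _ = m / n * M' * 8 := by ring
          have e1 : (16 * C₁ + 11) * ((m : ℝ) / 8) ≤ (16 * C₁ + 11) * ((m : ℝ) / n * M') :=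
            mul_le_mul_of_nonneg_left hmn' (by linarith)
          have e2 : C₁ * 1 ≤ C₁ * m := mul_le_mul_of_nonneg_left (by exact_mod_cast hm1) hC0
          have hm1' : (1 : ℝ) ≤ m := by exact_mod_cast hm1
          nlinarith [e1, e2, hm1', hC0]
  · have hn : n ≤ 2 * m + 9 := by omega
    have hn' : (n : ℝ) ≤ 2 * m + 9 := by exact_mod_cast hn
    have hC0 : 0 ≤ C₁ := by linarith
    have hCm : 0 ≤ C₁ * m := mul_nonneg hC0 hm0.le
    have hm1' : (1 : ℝ) ≤ m := by exact_mod_cast hm1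
    calc (triSitePercolation t).real (domArmEvent ![true, false] m n upperHalfPlane) ≤ 1 := hP1
      _ ≤ (16 * C₁ + 11) * (m / n) := by
          rw [mul_div_assoc', le_div_iff₀ hn0]
          nlinarith [hCm, hm1', hn']

end Literature.Probability.Percolation
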